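import Summits.ResolutionOfSingularities.ResolutionOfSingularities.Theorems.EquisingularLiftEquisingularLiftNatConeDeltaPlaneCharts
import Literature.AlgebraicGeometry.Resolution.Dehomogenization
import Mathlib.RingTheory.MvPolynomial.Ideal
import HarnessLib

/-!
# [OURS · L1 W4.5(b) · EL♮(3)] (δ) D2 FRAME-CHANGE — the ring kit moving a cluster point to the cone point of an adapted frame
# (crux `EquisingularLiftNatThree` stmt-ResolutionOfSingularities-20148 / parent 20038; rung v7′ TC⁺⁺, STEP 0 per subset)

NOT a statement of any manuscript. Helper file of the chain res-L1-w45b (cell `res-hironaka`, LADDER-RESOLUTION rung L, slot W4.5(b));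
OURS; AI-written, weaker than expert review; `--supports stmt-ResolutionOfSingularities-20148 --as helper` by res-L1-w45b-stub-3 (brick D2 of
`L/res-L1-w45b-stub-3/DELTA-PLAN.md`, booked by res-L1-w45b-plan-1 2026-08-27T16:20:41Z). No `sorry`; standard axioms; NO definitions (the
adapted frame and the substitution are carried as HYPOTHESES `hc'0 / hc's`, `hθi / hθs`, so consumers instantiate them with `Fin.cases` /
`Fin.insertNth` and discharge by `rfl` / `Fin.insertNth_apply_*`; `exists_frameSubst` / `exists_frameSubstInv` hand out witnesses).

WHAT. The per-point bricks of the cone point — res-type-100's B6a (p541628), res-D-pv-029's B6b glue (p545343), res-L1-w45b-stub-3's B6c ★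
(p545513 / p546375 / …NatCentredPackageFrameOver) and B7★ (p540595 / …NatConeDeltaPlaneChartsOver) — are written for THE CONE POINT `[1:0:0]`
of CHART `0` of a section frame `c = (c₀, c₁, c₂)`. A point `t` of a cluster ((δ) D1 `exists_clusterConeLift_subset`, p548257) sits on chart
`i = i t` with affine coordinates `a = a t : {j ≠ i} → O`. The ADAPTED FRAME `c' = (c_i, c_{i⁺0} − a₀ c_i, c_{i⁺1} − a₁ c_i)` (`i⁺l = i.succAbove l`)
spans the same ideal and has `t` as the cone point of its chart `0`; the form in the adapted coordinates is `Φ' = Φ ∘ θ` with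
`θ_i = X 0`, `θ_{i⁺l} = X (l+1) + a_l · X 0`. This file proves the dictionary the consumer of B6c ★ needs, all VERBATIM in B6c's binder shapes:
* `span_range_frame_eq` — `(c') = (c)`;
* `eval_map_aeval_frameSubst` — `Φ'(c') = Φ(c)` (so `hK₀` transfers);
* `isHomogeneous_aeval_frameSubst`, `map_aeval_frameSubst`, `aeval_frameSubstInv_aeval_frameSubst`, `aeval_frameSubst_ne_zero`;
* `aeval_dehomZero_aeval_frameSubst` — `Φ'(1, X 0, X 1)` is D1's shifted dehomogenisation `(dehomogenize i Φ)(X + a)` re-indexed along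
  `finSuccAboveEquiv i`; `aeval_dehomZero_eq_rename_dehomogenize` (the case `θ = id`);
* part 2 (…NatFrameChangeClauses): `frameSubst_centred` / `frameSubst_exact` / `frameSubst_stChart` (`_chartU`, `_chartV`) — D1's
  per-point clauses ⟹ B6c's `hcen` / `hexact` / `hΦu, hregu` / `hΦv, hregv` (pointed) for `Φ' = Φ ∘ θ`.

References: res-L1-w45b-stub-3 p548257 (D1), p539780 (`aeval_subst_zero_aeval_dehom`, `aeval_subst_one_aeval_dehom`); typed port
`Literature.AlgebraicGeometry.Resolution.Dehomogenization` [cite: CossartPiltant2008, proof of Prop. 4.2]; Mathlib `MvPolynomial.mem_pow_idealOfVars_iff`.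
-/

set_option linter.dupNamespace false -- mandated namespace `Summit.<Summit>.<Problem>` of this single-conjunct summit

noncomputable section

namespace Summit.ResolutionOfSingularities.ResolutionOfSingularities.Cruxes.EquisingularLiftNat.Sections.TCPlus

open MvPolynomial IsLocalRing Literature.AlgebraicGeometry.Resolution

/-! ## Generic helpers -/

section Helpers

variable {O : Type*} [CommRing O]

/-- Renaming variables keeps a polynomial inside the `m`-th power of the ideal of variables. [folklore] -/
theorem rename_mem_pow_idealOfVars {σ τ : Type*} (f : σ → τ) {p : MvPolynomial σ O} {m : ℕ}
    (hp : p ∈ idealOfVars σ O ^ m) : rename f p ∈ idealOfVars τ O ^ m := by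
  have hle : (idealOfVars σ O).map (rename f).toRingHom ≤ idealOfVars τ O := by
    rw [idealOfVars, Ideal.map_span, ← Set.range_comp]
    refine Ideal.span_le.2 (Set.range_subset_iff.2 fun j => ?_)
    simp only [Function.comp_apply, AlgHom.toRingHom_eq_coe, RingHom.coe_coe, rename_X]
    exact Ideal.subset_span (Set.mem_range_self _)
  have h := Ideal.mem_map_of_mem (rename f).toRingHom hp
  rw [Ideal.map_pow] at h
  exact Ideal.pow_right_mono hle m h

/-- The shift `X ↦ X + a` carries the `m`-th power of the point ideal `(X_j − a_j : j)` into the `m`-th power of the ideal of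
variables. [folklore] -/
theorem aeval_shift_mem_pow_idealOfVars {σ : Type*} (a : σ → O) {p : MvPolynomial σ O} {m : ℕ}
    (hp : p ∈ Ideal.span (Set.range fun j => (X j : MvPolynomial σ O) - C (a j)) ^ m) :
    aeval (fun j => (X j : MvPolynomial σ O) + C (a j)) p ∈ idealOfVars σ O ^ m := by
  have hle : (Ideal.span (Set.range fun j => (X j : MvPolynomial σ O) - C (a j))).map
      (aeval fun j => (X j : MvPolynomial σ O) + C (a j)).toRingHom ≤ idealOfVars σ O := by
    refine Ideal.map_le_iff_le_comap.2 (Ideal.span_le.2 (Set.range_subset_iff.2 fun j => ?_))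
    rw [SetLike.mem_coe, Ideal.mem_comap]
    simp only [AlgHom.toRingHom_eq_coe, RingHom.coe_coe, map_sub, MvPolynomial.aeval_X, MvPolynomial.aeval_C,
      MvPolynomial.algebraMap_eq, add_sub_cancel_right]
    exact Ideal.subset_span (Set.mem_range_self j)
  have h := Ideal.mem_map_of_mem (aeval fun j => (X j : MvPolynomial σ O) + C (a j)).toRingHom hp
  rw [Ideal.map_pow] at h
  exact Ideal.pow_right_mono hle m h

/-- A nonzero coefficient of a dehomogenisation comes from a monomial of the form. [folklore] -/
theorem exists_mem_support_of_coeff_dehomogenize_ne_zero {σ : Type*} [DecidableEq σ] (i : σ) (F : MvPolynomial σ O)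
    (γ : {j : σ // j ≠ i} →₀ ℕ) (h : coeff γ (dehomogenize i F) ≠ 0) :
    ∃ α ∈ F.support, α.subtypeDomain (· ≠ i) = γ := by
  rw [dehomogenize_eq_sum, coeff_sum] at h
  obtain ⟨α, hα, hne⟩ := Finset.exists_ne_zero_of_sum_ne_zero h
  refine ⟨α, hα, ?_⟩
  by_contra hαγ
  exact hne (by rw [coeff_monomial, if_neg hαγ])

/-- Local rings at corresponding primes of isomorphic rings: regularity transfers (`e⁻¹ Q' = Q`). [folklore] -/
theorem isRegularLocalRing_atPrime_of_ringEquiv {A B : Type*} [CommRing A] [CommRing B] (e : A ≃+* B)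
    (Q : Ideal A) (Q' : Ideal B) [Q.IsPrime] [Q'.IsPrime] (h : ∀ x : A, e x ∈ Q' ↔ x ∈ Q)
    (hreg : IsRegularLocalRing (Localization.AtPrime Q)) : IsRegularLocalRing (Localization.AtPrime Q') := by
  have hmap : Q.primeCompl.map e.toMonoidHom = Q'.primeCompl := by
    ext y
    simp only [Submonoid.mem_map, Ideal.mem_primeCompl_iff]
    constructor
    · rintro ⟨x, hx, rfl⟩
      exact fun hy => hx ((h x).mp hy)
    · intro hy
      refine ⟨e.symm y, fun hx => hy ?_, ?_⟩
      · have := (h (e.symm y)).mpr hx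
        rwa [e.apply_symm_apply] at this
      · change e (e.symm y) = y
        exact e.apply_symm_apply y
  haveI := hreg
  exact IsRegularLocalRing.of_ringEquiv (IsLocalization.ringEquivOfRingEquiv (M := Q.primeCompl) (T := Q'.primeCompl)
    (Localization.AtPrime Q) (Localization.AtPrime Q') e hmap)

/-- `finSuccAboveEquiv i` inverts `i.succAbove`. [folklore] -/
theorem finSuccAboveEquiv_symm_apply_succAbove {n : ℕ} (i : Fin (n + 1)) (l : Fin n) (h : i.succAbove l ≠ i) :
    (finSuccAboveEquiv i).symm ⟨i.succAbove l, h⟩ = l := by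
  rw [Equiv.symm_apply_eq]
  rfl

end Helpers

/-! ## The adapted frame -/

section Frame

variable {R : Type*} [CommRing R] (i : Fin 3)

/-- **(δ) D2 — the adapted frame spans the same ideal**: `c' = (c_i, c_{i⁺0} − e₀ c_i, c_{i⁺1} − e₁ c_i)` has `(c') = (c)`. [folklore]
[OURS · L1 W4.5b] -/
theorem span_range_frame_eq (e : Fin 2 → R) (c c' : Fin 3 → R) (hc'0 : c' 0 = c i)
    (hc's : ∀ l : Fin 2, c' l.succ = c (i.succAbove l) - e l * c i) :
    Ideal.span (Set.range c') = Ideal.span (Set.range c) := by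
  apply le_antisymm
  · refine Ideal.span_le.2 (Set.range_subset_iff.2 (Fin.forall_fin_succ.2 ⟨?_, fun l => ?_⟩))
    · rw [SetLike.mem_coe, hc'0]
      exact Ideal.subset_span (Set.mem_range_self i)
    · rw [SetLike.mem_coe, hc's]
      exact Ideal.sub_mem _ (Ideal.subset_span (Set.mem_range_self _))
        (Ideal.mul_mem_left _ _ (Ideal.subset_span (Set.mem_range_self i)))
  · refine Ideal.span_le.2 (Set.range_subset_iff.2 ((Fin.forall_iff_succAbove i).2 ⟨?_, fun l => ?_⟩))
    · rw [SetLike.mem_coe, ← hc'0]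
      exact Ideal.subset_span (Set.mem_range_self 0)
    · have h : c (i.succAbove l) = c' l.succ + e l * c' 0 := by rw [hc's, hc'0]; ring
      rw [SetLike.mem_coe, h]
      exact Ideal.add_mem _ (Ideal.subset_span (Set.mem_range_self _))
        (Ideal.mul_mem_left _ _ (Ideal.subset_span (Set.mem_range_self 0)))

end Frame

/-! ## The frame substitution on forms -/

section Subst

variable {O : Type*} [CommRing O] (i : Fin 3) (a : {j : Fin 3 // j ≠ i} → O)

/-- **(δ) D2 — a frame substitution exists** (`θ_i = X 0`, `θ_{i⁺l} = X (l+1) + a_l X 0`; `Fin.insertNth`). [folklore] -/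
theorem exists_frameSubst : ∃ θ : Fin 3 → MvPolynomial (Fin 3) O, θ i = X 0 ∧
    ∀ l : Fin 2, θ (i.succAbove l) = X l.succ + C (a ⟨i.succAbove l, Fin.succAbove_ne i l⟩) * X 0 :=
  ⟨Fin.insertNth (α := fun _ => MvPolynomial (Fin 3) O) i (X 0)
      fun l => X l.succ + C (a ⟨i.succAbove l, Fin.succAbove_ne i l⟩) * X 0,
    Fin.insertNth_apply_same _ _ _, fun l => Fin.insertNth_apply_succAbove _ _ _ l⟩

/-- **(δ) D2 — the inverse frame substitution exists** (`θ'_0 = X i`, `θ'_{l+1} = X (i⁺l) − a_l X i`; `Fin.cases`). [folklore] -/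
theorem exists_frameSubstInv : ∃ θ' : Fin 3 → MvPolynomial (Fin 3) O, θ' 0 = X i ∧
    ∀ l : Fin 2, θ' l.succ = X (i.succAbove l) - C (a ⟨i.succAbove l, Fin.succAbove_ne i l⟩) * X i :=
  ⟨Fin.cases (X i) fun l => X (i.succAbove l) - C (a ⟨i.succAbove l, Fin.succAbove_ne i l⟩) * X i, rfl, fun _ => rfl⟩

variable (θ : Fin 3 → MvPolynomial (Fin 3) O) (hθi : θ i = X 0)
  (hθs : ∀ l : Fin 2, θ (i.succAbove l) = X l.succ + C (a ⟨i.succAbove l, Fin.succAbove_ne i l⟩) * X 0)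

include hθi hθs

/-- **(δ) D2 — the substituted form is a form of the same degree.** [folklore] -/
theorem isHomogeneous_aeval_frameSubst {Φ : MvPolynomial (Fin 3) O} {d : ℕ} (hΦ : Φ.IsHomogeneous d) :
    (aeval θ Φ).IsHomogeneous d := by
  have hθ : ∀ j, (θ j).IsHomogeneous 1 := by
    refine (Fin.forall_iff_succAbove i).2 ⟨?_, fun l => ?_⟩
    · rw [hθi]
      exact isHomogeneous_X O 0
    · rw [hθs]
      exact (isHomogeneous_X O _).add (by simpa using (isHomogeneous_C (Fin 3) (a _)).mul (isHomogeneous_X O 0))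
  simpa using hΦ.aeval θ hθ

/-- **(δ) D2 — `Φ'(c') = Φ(c)`**: evaluating the substituted form at the adapted frame (after any change of coefficients `κ`) gives
the value of the form at the frame. [folklore] -/
theorem eval_map_aeval_frameSubst {R : Type*} [CommRing R] (κ : O →+* R) (c c' : Fin 3 → R) (hc'0 : c' 0 = c i)
    (hc's : ∀ l : Fin 2, c' l.succ = c (i.succAbove l) - κ (a ⟨i.succAbove l, Fin.succAbove_ne i l⟩) * c i)
    (Φ : MvPolynomial (Fin 3) O) :
    MvPolynomial.eval c' (MvPolynomial.map κ (aeval θ Φ)) = MvPolynomial.eval c (MvPolynomial.map κ Φ) := by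
  rw [MvPolynomial.aeval_eq_bind₁, MvPolynomial.map_bind₁]
  show MvPolynomial.eval₂Hom (RingHom.id R) c' (bind₁ _ (MvPolynomial.map κ Φ)) = _
  rw [MvPolynomial.eval₂Hom_bind₁]
  have hfun : (fun j => MvPolynomial.eval₂Hom (RingHom.id R) c' (MvPolynomial.map κ (θ j))) = c := by
    funext j
    revert j
    refine (Fin.forall_iff_succAbove i).2 ⟨?_, fun l => ?_⟩
    · rw [hθi, MvPolynomial.map_X, MvPolynomial.eval₂Hom_X', hc'0]
    · rw [hθs]
      simp only [map_add, map_mul, MvPolynomial.map_X, MvPolynomial.map_C, MvPolynomial.eval₂Hom_X', MvPolynomial.eval₂Hom_C,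
        hc's, hc'0, RingHom.id_apply]
      ring
  rw [hfun]
  rfl

/-- **(δ) D2 — change of coefficients commutes with the frame substitution** (the substitution over `S` has coefficients `f ∘ a`).
[folklore] -/
theorem map_aeval_frameSubst {S : Type*} [CommRing S] (f : O →+* S) (θf : Fin 3 → MvPolynomial (Fin 3) S) (hθfi : θf i = X 0)
    (hθfs : ∀ l : Fin 2, θf (i.succAbove l) = X l.succ + C (f (a ⟨i.succAbove l, Fin.succAbove_ne i l⟩)) * X 0)
    (Φ : MvPolynomial (Fin 3) O) : MvPolynomial.map f (aeval θ Φ) = aeval θf (MvPolynomial.map f Φ) := by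
  rw [MvPolynomial.aeval_eq_bind₁, MvPolynomial.map_bind₁, MvPolynomial.aeval_eq_bind₁]
  have hfun : (fun j => MvPolynomial.map f (θ j)) = θf := by
    funext j
    revert j
    refine (Fin.forall_iff_succAbove i).2 ⟨?_, fun l => ?_⟩
    · rw [hθi, hθfi, MvPolynomial.map_X]
    · rw [hθs, hθfs, map_add, map_mul, MvPolynomial.map_X, MvPolynomial.map_C, MvPolynomial.map_X]
  rw [hfun]

/-- **(δ) D2 — the inverse substitution undoes the substitution.** [folklore] -/
theorem aeval_frameSubstInv_aeval_frameSubst (θ' : Fin 3 → MvPolynomial (Fin 3) O) (hθ'0 : θ' 0 = X i)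
    (hθ's : ∀ l : Fin 2, θ' l.succ = X (i.succAbove l) - C (a ⟨i.succAbove l, Fin.succAbove_ne i l⟩) * X i)
    (Φ : MvPolynomial (Fin 3) O) : aeval θ' (aeval θ Φ) = Φ := by
  rw [MvPolynomial.comp_aeval_apply]
  have hfun : (fun j => aeval θ' (θ j)) = X := by
    funext j
    revert j
    refine (Fin.forall_iff_succAbove i).2 ⟨?_, fun l => ?_⟩
    · rw [hθi, MvPolynomial.aeval_X, hθ'0]
    · rw [hθs, map_add, map_mul, MvPolynomial.aeval_X, MvPolynomial.aeval_C, MvPolynomial.aeval_X, hθ's, hθ'0,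
        MvPolynomial.algebraMap_eq]
      ring
  rw [hfun, MvPolynomial.aeval_X_left_apply]

/-- **(δ) D2 — the substitution kills no form**: `Φ ≠ 0 → Φ ∘ θ ≠ 0`. [folklore] -/
theorem aeval_frameSubst_ne_zero {Φ : MvPolynomial (Fin 3) O} (hΦ : Φ ≠ 0) : aeval θ Φ ≠ 0 := by
  obtain ⟨θ', hθ'0, hθ's⟩ := exists_frameSubstInv i a
  intro h
  apply hΦ
  rw [← aeval_frameSubstInv_aeval_frameSubst i a θ hθi hθs θ' hθ'0 hθ's Φ, h, map_zero]

/-- **(δ) D2 — dehomogenising the substituted form at the new chart `0`** gives D1's shifted dehomogenisation at chart `i`,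
re-indexed along `finSuccAboveEquiv i`: `Φ'(1, X 0, X 1) = ((dehomogenize i Φ)(X + a))[X_{i⁺l} ↦ X l]`. [folklore] -/
theorem aeval_dehomZero_aeval_frameSubst (Φ : MvPolynomial (Fin 3) O) :
    aeval (![1, X 0, X 1] : Fin 3 → MvPolynomial (Fin 2) O) (aeval θ Φ) =
      rename (fun j => (finSuccAboveEquiv i).symm j)
        (aeval (fun j => (X j : MvPolynomial {j : Fin 3 // j ≠ i} O) + C (a j)) (dehomogenize i Φ)) := by
  classical
  have h1 : aeval (![1, X 0, X 1] : Fin 3 → MvPolynomial (Fin 2) O) (aeval θ Φ) =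
      aeval (fun j => aeval (![1, X 0, X 1] : Fin 3 → MvPolynomial (Fin 2) O) (θ j)) Φ :=
    MvPolynomial.comp_aeval_apply _ _ _
  have h2 : rename (fun j => (finSuccAboveEquiv i).symm j)
      (aeval (fun j => (X j : MvPolynomial {j : Fin 3 // j ≠ i} O) + C (a j)) (dehomogenize i Φ)) =
      aeval (fun j => rename (fun j => (finSuccAboveEquiv i).symm j)
        (aeval (fun j => (X j : MvPolynomial {j : Fin 3 // j ≠ i} O) + C (a j)) (killVar (R := O) i j))) Φ := by
    rw [show dehomogenize i Φ = aeval (killVar i) Φ from rfl, MvPolynomial.comp_aeval_apply (φ := aeval _),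
      MvPolynomial.comp_aeval_apply (φ := rename _)]
  have hfun : (fun j => aeval (![1, X 0, X 1] : Fin 3 → MvPolynomial (Fin 2) O) (θ j)) =
      fun j => rename (fun j => (finSuccAboveEquiv i).symm j)
        (aeval (fun j => (X j : MvPolynomial {j : Fin 3 // j ≠ i} O) + C (a j)) (killVar (R := O) i j)) := by
    funext j
    revert j
    refine (Fin.forall_iff_succAbove i).2 ⟨?_, fun l => ?_⟩
    · rw [hθi, killVar_self, map_one, map_one, MvPolynomial.aeval_X]
      rfl
    · rw [hθs, killVar_of_ne i (Fin.succAbove_ne i l), map_add, map_mul, MvPolynomial.aeval_X, MvPolynomial.aeval_C,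
        MvPolynomial.aeval_X, MvPolynomial.aeval_X, map_add, MvPolynomial.rename_X, MvPolynomial.rename_C,
        finSuccAboveEquiv_symm_apply_succAbove, MvPolynomial.algebraMap_eq]
      have hl : l = 0 ∨ l = 1 := by fin_cases l <;> simp
      rcases hl with rfl | rfl <;> simp
  rw [h1, h2, hfun]

end Subst

/-! ## Dehomogenising at chart `0` versus `Literature`'s `dehomogenize 0` -/

section DehomZero

variable {O : Type*} [CommRing O]

/-- `Ψ(1, X 0, X 1)` is `dehomogenize 0 Ψ` re-indexed along `finSuccAboveEquiv 0` (`{j ≠ 0} ≃ Fin 2`). [folklore] -/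
theorem aeval_dehomZero_eq_rename_dehomogenize (Ψ : MvPolynomial (Fin 3) O) :
    aeval (![1, X 0, X 1] : Fin 3 → MvPolynomial (Fin 2) O) Ψ =
      rename (fun j => (finSuccAboveEquiv (0 : Fin 3)).symm j) (dehomogenize 0 Ψ) := by
  have h := aeval_dehomZero_aeval_frameSubst (0 : Fin 3) (fun _ => 0) X rfl (fun l => by simp) Ψ
  simpa only [MvPolynomial.aeval_X_left_apply, MvPolynomial.C_0, add_zero] using h

/-- The exponent of `Ψ(1, X 0, X 1)` corresponding to `α`: `l ↦ α (l+1)`. [folklore] -/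
theorem mapDomain_subtypeDomain_apply (α : Fin 3 →₀ ℕ) (l : Fin 2) :
    Finsupp.mapDomain (fun j => (finSuccAboveEquiv (0 : Fin 3)).symm j) (α.subtypeDomain (· ≠ (0 : Fin 3))) l = α l.succ := by
  rw [show (fun j : {j : Fin 3 // j ≠ (0 : Fin 3)} => (finSuccAboveEquiv (0 : Fin 3)).symm j) =
      ⇑(finSuccAboveEquiv (0 : Fin 3)).symm from rfl, Finsupp.mapDomain_equiv_apply, Equiv.symm_symm,
    finSuccAboveEquiv_apply, Finsupp.subtypeDomain_apply]
  exact congrArg α (Fin.succAbove_zero_apply l)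

/-- Degree of that exponent: `α 1 + α 2`. [folklore] -/
theorem degree_mapDomain_subtypeDomain (α : Fin 3 →₀ ℕ) :
    (Finsupp.mapDomain (fun j => (finSuccAboveEquiv (0 : Fin 3)).symm j) (α.subtypeDomain (· ≠ (0 : Fin 3)))).degree =
      α 1 + α 2 := by
  rw [Finsupp.degree_eq_sum, Fin.sum_univ_two, mapDomain_subtypeDomain_apply, mapDomain_subtypeDomain_apply]
  rfl

end DehomZero

end Summit.ResolutionOfSingularities.ResolutionOfSingularities.Cruxes.EquisingularLiftNat.Sections.TCPlus

end
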